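import Summits.QuantumFields.BalabanUV.Beta.D1BFx.LatticeHLSRadial

/-!
# `BalabanUV.Beta.D1BFx.LatticeHLS` — road «BF-x» for binder row D1, letter (L5) of the gluon needle rows T₁∕T₂∕T₃ (owner spec
# `GLUON-NEEDLE-ROWS.md` v0.1 ∕ ruling ρ-g9-33, claimable «GN-L5 HLS KIT»), PART 2 of 3: THE TWO-CENTRE LATTICE HARDY–LITTLEWOOD–SOBOLEV SUMS
# `Σ_x nrm(x−u)^{−a}·nrm(x−v)^{−b}` ON `ℤ^d`, UNIFORM OVER FINITE SETS — super-critical `a+b ≥ d+1` (`≤ C∕nrm(u−v)^{a+b−d}`), critical `a+b = d`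
# with scale-`n` damping (`≤ C(δ)(1 + log n)`), and the region lemmas they are assembled from

HONEST FRAMING (cell contract, verbatim): «discharging `BetaPertH` makes Bałaban's UV stability UNCONDITIONAL — a real constructive-QFT
result; it is NOT the continuum limit and NOT the Clay problem.»  HONEST DEPENDENCY (verbatim): «continuum YM on T⁴ ⇐ BetaPertH ∧ nine
spine estimates (0/9 proved); BetaPertH ⇐ (D1) ∧ (D4) ∧ CAP+tail; G-an2-4 gates asym, D1 and NE2/3/4.»  THIS MODULE DISCHARGES NOTHING
of D1 ∕ BetaPertH: it is [folklore] counting on `ℤ^d` composed BY NAME from part 1 (`D1BFx.LatticeHLSRadial`: windows, tails, damped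
critical sum) and `PoissonInterior.{supNorm, nrm}`; it cites nothing, mints no `Prop`, asserts nothing of Bałaban's papers; 0 binders;
(K) NOT closed; NOT D1, NOT BetaPertH, NOT continuum, NOT Clay.
WHY (an3-g57 `N36-SPLIT.v1.md` §3′ (3), ADOPTED in ρ-g9-33): the PROFILE convolutions of the T₃ ∕ T₁ ∕ T₂ ledgers — `(Ga∇ρ_u)(ξ) ≤ k n⁻²·nrm(ξ−u)⁻¹`,
`Φ_u(x) = Σ_{x′}|∇Ga(x,x′)|·|row_u(x′)|`, `𝔅(ρ_u,ρ_{u′}) ≤ k n⁻⁴·(1 + log)` — are «discrete `Σ_x nrm(x−u)^{−a}·nrm(x−u′)^{−b} ≤ c·nrm(u−u′)^{4−a−b}`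
for `a,b < 4 < a+b`, `c·(1+log)` at `a+b = 4` — standard lattice HLS sums; in tree only `PoissonInterior.sum_cube_inv_nrm_pow_le`».  Here they are,
for general `d`, every bound UNIFORM over `S : Finset (Site d)` and the centres (so block sums, `fullSum` and `tsum` consumers are all served).
METHOD ([folklore]): `R := ‖u−v‖∞`; three regions — NEAR `u` (`2‖x−u‖∞ ≤ R`, where `nrm(x−v) ≥ (R+1)∕3`: part 1's window sum at `u`), NEAR `v`
(symmetric), FAR (both fail, where `nrm(x−v) ≤ 3·nrm(x−u)` and `‖x−v‖∞ ≥ (R+1)∕2`: part 1's super-critical tail at `v`); in the critical damped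
case the complement of NEAR `u` is compared with part 1's damped critical one-centre sum at `v`.
CONTENT.  §1 distance comparisons in the regions; §2 region lemmas `sum_near_le` (`a ≤ d−1`), `sum_near_crit_le` (`a = d`, log), `sum_far_le`
(`a+b ≥ d+1`) — exposed so that exponent patterns outside §3's hypotheses (e.g. one critical exponent) assemble in three lines; §3 **`sum_inv_nrm_pow_mul_le`**:
`Σ_{x∈S} 1∕(nrm(x−u)^a nrm(x−v)^b) ≤ d·2^{d+3}·9^{d−1}∕nrm(u−v)^{a+b−d}` (`a, b ≤ d−1`, `a+b ≥ d+1`); §4 **`sum_exp_div_nrm_pow_mul_crit_le`**: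
`Σ_{x∈S} e^{−(δ∕n)‖x−v‖∞}∕(nrm(x−u)^a nrm(x−v)^b) ≤ 3^{d−1}(1 + 2d·3^{d−1})(3 + 2∕δ + log n)` (`a, b ≤ d−1`, `a+b = d`; owner ρ-g10-1 (N3): the `1 + log n`
form, the finer `log(n∕nrm(u−v))` not requested).  Part 3 (`D1BFx.LatticeHLSProfiles`) packages these as kernel∘profile bounds `|Σ K·f|` (ρ-g10-1 (N2)), adds the
damping-centre-free one-centre sums (an3 [AN3-G58-GNL5-2] (b′)), the `Summable`∕`tsum` forms and the `d = 4` reading.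
PRIOR ART IN THE TREE (owner ρ-g10-1 (N1)): road FP's `Beta/FP/LatticeConvolutionBounds` (d = 4, `(‖v‖∞+1)` currency) has the one-centre `t ≥ 5` sums
(`sum_inv_pow_le`∕`tsum_inv_pow_le`, constant 81) and a two-centre bound `tsum_two_centre_le` ∕ `tsum_kernel_profile_le` ∕ `tsum_profile_profile_le` with exponent
`s = a+b−5` — ONE POWER LOSSY against the HLS exponent `a+b−4` ((3,3) ↦ R⁻¹ vs R⁻²; (2,3) ↦ R⁰ vs R⁻¹), which ρ-g9-33 says breaks T₃'s flatness; §3 here IS the sharp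
letter and supersedes those three for the needle rows (currency bridge: `nrm v ≤ ‖v‖∞ + 1 ≤ 2·nrm v`).  Nothing of that file is re-proved or imported.
Constants explicit and crude.  Unit `b2b-balaban-beta-d1-formalise-leaf-04` (gen 9), claim «GN-L5 HLS KIT» (journal 2026-08-21 l.29970; GO ρ-g10-1 l.30007).
-/

namespace Summit.QuantumFields.BalabanUV.Beta.D1BFx.LatticeHLS

open Finset Real
open Literature.Probability.LatticeModels (Site)
open Literature.MathematicalPhysics.QuantumFieldTheory.Balaban1983to89.Beta
open PoissonInterior (supNorm nrm supNorm_neg supNorm_add_le one_le_nrm nrm_pos supNorm_le_nrm)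
open LatticeHLSRadial (nrm_eq_max sum_inv_nrm_pow_le sum_inv_nrm_pow_crit_le sum_inv_nrm_pow_tail_le sum_exp_div_nrm_pow_crit_le)

variable {d : ℕ}

/-! ## §1 Distance comparisons in the three regions -/

/-- [folklore] NEAR ONE CENTRE, FAR FROM THE OTHER: `2‖x−u‖∞ ≤ ‖u−v‖∞` forces `nrm(x−v) ≥ (‖u−v‖∞ + 1)∕3`. -/
theorem nrm_ge_of_near {x u v : Site d} (h : 2 * supNorm (x - u) ≤ supNorm (u - v)) :
    ((supNorm (u - v) : ℝ) + 1) / 3 ≤ nrm (x - v) := by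
  have h1 : supNorm (u - v) ≤ supNorm (x - u) + supNorm (x - v) := by
    have := supNorm_add_le (u - x) (x - v)
    rwa [show u - x + (x - v) = u - v by abel, show u - x = -(x - u) by abel, supNorm_neg] at this
  have h2 : (supNorm (u - v) : ℝ) ≤ 2 * supNorm (x - v) := by exact_mod_cast (by omega : supNorm (u - v) ≤ 2 * supNorm (x - v))
  have h3 := one_le_nrm (x - v)
  have h4 := supNorm_le_nrm (x - v)
  rcases le_or_gt (supNorm (u - v) : ℝ) 2 with h5 | h5 <;> linarith

/-- [folklore] FAR FROM A CENTRE the two distances compare: `‖u−v‖∞ < 2‖x−u‖∞` gives `nrm(x−v) ≤ 3·nrm(x−u)`, hence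
`1∕nrm(x−u)^a ≤ 3^a∕nrm(x−v)^a`. -/
theorem inv_nrm_pow_le_of_far {x u v : Site d} (h : supNorm (u - v) < 2 * supNorm (x - u)) (a : ℕ) :
    1 / nrm (x - u) ^ a ≤ 3 ^ a / nrm (x - v) ^ a := by
  have h1 : supNorm (x - v) ≤ supNorm (x - u) + supNorm (u - v) := by
    have := supNorm_add_le (x - u) (u - v)
    rwa [show x - u + (u - v) = x - v by abel] at this
  have h2 : (supNorm (x - v) : ℝ) ≤ 3 * supNorm (x - u) := by exact_mod_cast (by omega : supNorm (x - v) ≤ 3 * supNorm (x - u))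
  have h3 := one_le_nrm (x - u)
  have h4 := supNorm_le_nrm (x - u)
  have h5 := nrm_pos (x - v)
  have hle : nrm (x - v) ≤ 3 * nrm (x - u) := by rw [nrm_eq_max (x - v)]; exact max_le (by linarith) (by linarith)
  have h6 : nrm (x - v) ^ a ≤ 3 ^ a * nrm (x - u) ^ a := by rw [← mul_pow]; exact pow_le_pow_left₀ h5.le hle a
  rw [div_le_div_iff₀ (by positivity) (by positivity), one_mul]
  exact h6

/-- [folklore] FAR FROM A CENTRE, integer form: `‖u−v‖∞ < 2‖x−v‖∞` gives `(‖u−v‖∞ + 2)∕2 ≤ ‖x−v‖∞` (ℕ-division) — a radius `≥ 1` and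
`≥ (‖u−v‖∞+1)∕2`. -/
theorem half_le_supNorm_of_far {x u v : Site d} (h : supNorm (u - v) < 2 * supNorm (x - v)) :
    (supNorm (u - v) + 2) / 2 ≤ supNorm (x - v) := by
  omega

/-! ## §2 The region lemmas -/

/-- [folklore] **NEAR REGION, sub-critical exponent at the near centre** (`a ≤ d−1`): over the points with `2‖x−u‖∞ ≤ ‖u−v‖∞ =: R`,
`Σ 1∕(nrm(x−u)^a·nrm(x−v)^b) ≤ 3^b·(1 + 2d·3^{d−1})·(R+1)^{d−a}∕(R+1)^b` (part 1's window at `u`; the other factor frozen at `((R+1)∕3)^{−b}`). -/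
theorem sum_near_le (hd : 0 < d) {a : ℕ} (ha : a ≤ d - 1) (b : ℕ) (S : Finset (Site d)) (u v : Site d)
    (hS : ∀ x ∈ S, 2 * supNorm (x - u) ≤ supNorm (u - v)) :
    ∑ x ∈ S, 1 / (nrm (x - u) ^ a * nrm (x - v) ^ b)
      ≤ 3 ^ b * (1 + 2 * d * 3 ^ (d - 1)) * ((supNorm (u - v) : ℝ) + 1) ^ (d - a) / ((supNorm (u - v) : ℝ) + 1) ^ b := by
  set R := supNorm (u - v)
  have hR0 : (0 : ℝ) < (R : ℝ) + 1 := by positivity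
  have hpt : ∀ x ∈ S, 1 / (nrm (x - u) ^ a * nrm (x - v) ^ b) ≤ (3 / ((R : ℝ) + 1)) ^ b * (1 / nrm (x - u) ^ a) := by
    intro x hx
    have h1 := nrm_ge_of_near (hS x hx)
    have h2 := nrm_pos (x - u)
    have h4 : (0 : ℝ) < ((R : ℝ) + 1) / 3 := by positivity
    calc 1 / (nrm (x - u) ^ a * nrm (x - v) ^ b) ≤ 1 / (nrm (x - u) ^ a * (((R : ℝ) + 1) / 3) ^ b) :=
          one_div_le_one_div_of_le (by positivity) (mul_le_mul_of_nonneg_left (pow_le_pow_left₀ h4.le h1 b) (by positivity))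
      _ = (3 / ((R : ℝ) + 1)) ^ b * (1 / nrm (x - u) ^ a) := by rw [div_pow, div_pow]; field_simp
  have hwin : ∀ x ∈ S, supNorm (x - u) ≤ R := fun x hx => by have := hS x hx; omega
  have h1 : (1 : ℝ) ≤ ((R : ℝ) + 1) ^ (d - a) := one_le_pow₀ (by linarith)
  have h2 : (R : ℝ) ^ (d - a) ≤ ((R : ℝ) + 1) ^ (d - a) := pow_le_pow_left₀ (Nat.cast_nonneg R) (by linarith) _
  have h3 : (0 : ℝ) ≤ 2 * d * 3 ^ (d - 1) := by positivity
  calc ∑ x ∈ S, 1 / (nrm (x - u) ^ a * nrm (x - v) ^ b) ≤ ∑ x ∈ S, (3 / ((R : ℝ) + 1)) ^ b * (1 / nrm (x - u) ^ a) :=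
        Finset.sum_le_sum hpt
    _ = (3 / ((R : ℝ) + 1)) ^ b * ∑ x ∈ S, 1 / nrm (x - u) ^ a := by rw [Finset.mul_sum]
    _ ≤ (3 / ((R : ℝ) + 1)) ^ b * (1 + 2 * d * 3 ^ (d - 1) * (R : ℝ) ^ (d - a)) :=
        mul_le_mul_of_nonneg_left (sum_inv_nrm_pow_le hd ha S u hwin) (by positivity)
    _ ≤ (3 / ((R : ℝ) + 1)) ^ b * ((1 + 2 * d * 3 ^ (d - 1)) * ((R : ℝ) + 1) ^ (d - a)) := by
        apply mul_le_mul_of_nonneg_left _ (by positivity); nlinarith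
    _ = _ := by rw [div_pow]; ring

/-- [folklore] **NEAR REGION, critical exponent at the near centre** (`a = d`): over the points with `2‖x−u‖∞ ≤ R`,
`Σ 1∕(nrm(x−u)^d·nrm(x−v)^b) ≤ 3^b·(1 + 2d·3^{d−1}·(1 + log R))∕(R+1)^b` (part 1's critical window at `u`). -/
theorem sum_near_crit_le (hd : 0 < d) (b : ℕ) (S : Finset (Site d)) (u v : Site d)
    (hS : ∀ x ∈ S, 2 * supNorm (x - u) ≤ supNorm (u - v)) :
    ∑ x ∈ S, 1 / (nrm (x - u) ^ d * nrm (x - v) ^ b)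
      ≤ 3 ^ b * (1 + 2 * d * 3 ^ (d - 1) * (1 + Real.log (supNorm (u - v)))) / ((supNorm (u - v) : ℝ) + 1) ^ b := by
  set R := supNorm (u - v)
  have hR0 : (0 : ℝ) < (R : ℝ) + 1 := by positivity
  have hpt : ∀ x ∈ S, 1 / (nrm (x - u) ^ d * nrm (x - v) ^ b) ≤ (3 / ((R : ℝ) + 1)) ^ b * (1 / nrm (x - u) ^ d) := by
    intro x hx
    have h1 := nrm_ge_of_near (hS x hx)
    have h2 := nrm_pos (x - u)
    have h4 : (0 : ℝ) < ((R : ℝ) + 1) / 3 := by positivity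
    calc 1 / (nrm (x - u) ^ d * nrm (x - v) ^ b) ≤ 1 / (nrm (x - u) ^ d * (((R : ℝ) + 1) / 3) ^ b) :=
          one_div_le_one_div_of_le (by positivity) (mul_le_mul_of_nonneg_left (pow_le_pow_left₀ h4.le h1 b) (by positivity))
      _ = (3 / ((R : ℝ) + 1)) ^ b * (1 / nrm (x - u) ^ d) := by rw [div_pow, div_pow]; field_simp
  have hwin : ∀ x ∈ S, supNorm (x - u) ≤ R := fun x hx => by have := hS x hx; omega
  calc ∑ x ∈ S, 1 / (nrm (x - u) ^ d * nrm (x - v) ^ b) ≤ ∑ x ∈ S, (3 / ((R : ℝ) + 1)) ^ b * (1 / nrm (x - u) ^ d) :=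
        Finset.sum_le_sum hpt
    _ = (3 / ((R : ℝ) + 1)) ^ b * ∑ x ∈ S, 1 / nrm (x - u) ^ d := by rw [Finset.mul_sum]
    _ ≤ (3 / ((R : ℝ) + 1)) ^ b * (1 + 2 * d * 3 ^ (d - 1) * (1 + Real.log R)) :=
        mul_le_mul_of_nonneg_left (sum_inv_nrm_pow_crit_le hd S u hwin) (by positivity)
    _ = _ := by rw [div_pow]; ring

/-- [folklore] **FAR REGION** (`a + b ≥ d+1`, any `a, b`): over the points with `2‖x−u‖∞ > R` and `2‖x−v‖∞ > R`,
`Σ 1∕(nrm(x−u)^a·nrm(x−v)^b) ≤ 3^a·4d·3^{d−1}·2^{a+b−d}∕(R+1)^{a+b−d}` (`1∕nrm(x−u)^a ≤ 3^a∕nrm(x−v)^a`, then part 1's tail at `v`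
beyond radius `(R+2)∕2 ≥ (R+1)∕2`). -/
theorem sum_far_le (hd : 0 < d) {a b : ℕ} (hab : d + 1 ≤ a + b) (S : Finset (Site d)) (u v : Site d)
    (hSu : ∀ x ∈ S, supNorm (u - v) < 2 * supNorm (x - u)) (hSv : ∀ x ∈ S, supNorm (u - v) < 2 * supNorm (x - v)) :
    ∑ x ∈ S, 1 / (nrm (x - u) ^ a * nrm (x - v) ^ b)
      ≤ 3 ^ a * (4 * d * 3 ^ (d - 1)) * 2 ^ (a + b - d) / ((supNorm (u - v) : ℝ) + 1) ^ (a + b - d) := by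
  set R := supNorm (u - v)
  have hR0 : (0 : ℝ) < (R : ℝ) + 1 := by positivity
  set m := (R + 2) / 2 with hm
  have hm1 : 1 ≤ m := by omega
  have hm0 : (0 : ℝ) < m := by exact_mod_cast hm1
  have hmR : ((R : ℝ) + 1) / 2 ≤ m := by
    have h : R + 1 ≤ 2 * m := by omega
    have h' : (R : ℝ) + 1 ≤ 2 * m := by exact_mod_cast h
    linarith
  have hfar : ∀ x ∈ S, m ≤ supNorm (x - v) := fun x hx => half_le_supNorm_of_far (hSv x hx)
  have hpt : ∀ x ∈ S, 1 / (nrm (x - u) ^ a * nrm (x - v) ^ b) ≤ 3 ^ a * (1 / nrm (x - v) ^ (a + b)) := by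
    intro x hx
    have h1 := inv_nrm_pow_le_of_far (hSu x hx) a
    have h3 := nrm_pos (x - v)
    calc 1 / (nrm (x - u) ^ a * nrm (x - v) ^ b) = 1 / nrm (x - u) ^ a * (1 / nrm (x - v) ^ b) := by rw [one_div_mul_one_div]
      _ ≤ 3 ^ a / nrm (x - v) ^ a * (1 / nrm (x - v) ^ b) := mul_le_mul_of_nonneg_right h1 (by positivity)
      _ = 3 ^ a * (1 / nrm (x - v) ^ (a + b)) := by rw [pow_add]; field_simp
  calc ∑ x ∈ S, 1 / (nrm (x - u) ^ a * nrm (x - v) ^ b) ≤ ∑ x ∈ S, 3 ^ a * (1 / nrm (x - v) ^ (a + b)) := Finset.sum_le_sum hpt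
    _ = 3 ^ a * ∑ x ∈ S, 1 / nrm (x - v) ^ (a + b) := by rw [Finset.mul_sum]
    _ ≤ 3 ^ a * (4 * d * 3 ^ (d - 1) / (m : ℝ) ^ (a + b - d)) :=
        mul_le_mul_of_nonneg_left (sum_inv_nrm_pow_tail_le hd hab S v hm1 hfar) (by positivity)
    _ ≤ 3 ^ a * (4 * d * 3 ^ (d - 1) / (((R : ℝ) + 1) / 2) ^ (a + b - d)) := by gcongr
    _ = _ := by rw [div_pow]; field_simp

/-! ## §3 Two centres, super-critical -/

/-- [folklore] **THE LATTICE HLS INEQUALITY** (`a, b ≤ d−1`, `a + b ≥ d+1`; every finite `S`, all centres):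
`Σ_{x∈S} 1∕(nrm(x−u)^a·nrm(x−v)^b) ≤ d·2^{d+3}·9^{d−1} ∕ nrm(u−v)^{a+b−d}` (near `u` + near `v` + far; `nrm(u−v) ≤ ‖u−v‖∞ + 1`). -/
theorem sum_inv_nrm_pow_mul_le (hd : 0 < d) {a b : ℕ} (ha : a ≤ d - 1) (hb : b ≤ d - 1) (hab : d + 1 ≤ a + b)
    (S : Finset (Site d)) (u v : Site d) :
    ∑ x ∈ S, 1 / (nrm (x - u) ^ a * nrm (x - v) ^ b) ≤ d * 2 ^ (d + 3) * 9 ^ (d - 1) / nrm (u - v) ^ (a + b - d) := by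
  classical
  set R := supNorm (u - v) with hRdef
  have hR0 : (0 : ℝ) < (R : ℝ) + 1 := by positivity
  have hRv : supNorm (v - u) = R := by rw [show v - u = -(u - v) by abel, supNorm_neg]
  set κ : ℝ := 2 * d * 3 ^ (d - 1) with hκ
  have hκ0 : 0 ≤ κ := by positivity
  set f : Site d → ℝ := fun x => 1 / (nrm (x - u) ^ a * nrm (x - v) ^ b) with hf
  set S' := S.filter (fun x => ¬2 * supNorm (x - u) ≤ R)
  have hsplit : ∑ x ∈ S, f x = ∑ x ∈ S.filter (fun x => 2 * supNorm (x - u) ≤ R), f x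
      + (∑ x ∈ S'.filter (fun x => 2 * supNorm (x - v) ≤ R), f x + ∑ x ∈ S'.filter (fun x => ¬2 * supNorm (x - v) ≤ R), f x) := by
    rw [Finset.sum_filter_add_sum_filter_not, Finset.sum_filter_add_sum_filter_not]
  have eb : ((R : ℝ) + 1) ^ b = ((R : ℝ) + 1) ^ (a + b - d) * ((R : ℝ) + 1) ^ (d - a) := by rw [← pow_add]; congr 1; omega
  have ea : ((R : ℝ) + 1) ^ a = ((R : ℝ) + 1) ^ (a + b - d) * ((R : ℝ) + 1) ^ (d - b) := by rw [← pow_add]; congr 1; omega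
  -- near u
  have hU : ∑ x ∈ S.filter (fun x => 2 * supNorm (x - u) ≤ R), f x ≤ 3 ^ b * (1 + κ) / ((R : ℝ) + 1) ^ (a + b - d) := by
    have h := sum_near_le hd ha b (S.filter (fun x => 2 * supNorm (x - u) ≤ R)) u v (fun x hx => (Finset.mem_filter.mp hx).2)
    rw [← hRdef, eb, ← hκ] at h
    refine le_trans h (le_of_eq ?_)
    field_simp
  -- near v (roles of `u`, `v` swapped)
  have hV : ∑ x ∈ S'.filter (fun x => 2 * supNorm (x - v) ≤ R), f x ≤ 3 ^ a * (1 + κ) / ((R : ℝ) + 1) ^ (a + b - d) := by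
    have h := sum_near_le hd hb a (S'.filter (fun x => 2 * supNorm (x - v) ≤ R)) v u
      (fun x hx => by rw [hRv]; exact (Finset.mem_filter.mp hx).2)
    rw [hRv, ea, ← hκ] at h
    calc ∑ x ∈ S'.filter (fun x => 2 * supNorm (x - v) ≤ R), f x
        = ∑ x ∈ S'.filter (fun x => 2 * supNorm (x - v) ≤ R), 1 / (nrm (x - v) ^ b * nrm (x - u) ^ a) :=
          Finset.sum_congr rfl fun x _ => by rw [hf, mul_comm]
      _ ≤ _ := h
      _ = 3 ^ a * (1 + κ) / ((R : ℝ) + 1) ^ (a + b - d) := by field_simp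
  -- far
  have hF : ∑ x ∈ S'.filter (fun x => ¬2 * supNorm (x - v) ≤ R), f x ≤ 3 ^ a * (2 * κ) * 2 ^ (a + b - d) / ((R : ℝ) + 1) ^ (a + b - d) := by
    have h := sum_far_le hd hab (S'.filter (fun x => ¬2 * supNorm (x - v) ≤ R)) u v
      (fun x hx => not_le.mp (Finset.mem_filter.mp (Finset.mem_filter.mp hx).1).2) (fun x hx => not_le.mp (Finset.mem_filter.mp hx).2)
    rw [← hRdef] at h
    refine le_trans h (le_of_eq ?_)
    rw [hκ]; ring
  -- crude constants: `3^a, 3^b ≤ 3^{d−1}`, `2^{a+b−d} ≤ 2^d`, `1 + κ ≤ 3d·3^{d−1}`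
  have h3a : (3 : ℝ) ^ a ≤ 3 ^ (d - 1) := pow_le_pow_right₀ (by norm_num) ha
  have h3b : (3 : ℝ) ^ b ≤ 3 ^ (d - 1) := pow_le_pow_right₀ (by norm_num) hb
  have h2ab : (2 : ℝ) ^ (a + b - d) ≤ 2 ^ d := pow_le_pow_right₀ (by norm_num) (by omega)
  have hd1 : (1 : ℝ) ≤ d := by exact_mod_cast hd
  have h31 : (1 : ℝ) ≤ 3 ^ (d - 1) := one_le_pow₀ (by norm_num)
  have hκ1 : 1 + κ ≤ 3 * d * 3 ^ (d - 1) := by rw [hκ]; nlinarith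
  have h2d : (2 : ℝ) ≤ 2 ^ d := by
    calc (2 : ℝ) = 2 ^ 1 := by norm_num
      _ ≤ 2 ^ d := pow_le_pow_right₀ (by norm_num) hd
  have hnum : 3 ^ b * (1 + κ) + (3 ^ a * (1 + κ) + 3 ^ a * (2 * κ) * 2 ^ (a + b - d)) ≤ (d : ℝ) * 2 ^ (d + 3) * 9 ^ (d - 1) := by
    have hκ' : 2 * κ ≤ 4 * d * 3 ^ (d - 1) := by rw [hκ]; nlinarith
    have h9 : (9 : ℝ) ^ (d - 1) = 3 ^ (d - 1) * 3 ^ (d - 1) := by rw [← mul_pow]; norm_num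
    calc 3 ^ b * (1 + κ) + (3 ^ a * (1 + κ) + 3 ^ a * (2 * κ) * 2 ^ (a + b - d))
        ≤ 3 ^ (d - 1) * (3 * d * 3 ^ (d - 1)) + (3 ^ (d - 1) * (3 * d * 3 ^ (d - 1)) + 3 ^ (d - 1) * (4 * d * 3 ^ (d - 1)) * 2 ^ d) := by
          gcongr
      _ = (d : ℝ) * (3 ^ (d - 1) * 3 ^ (d - 1)) * (6 + 4 * 2 ^ d) := by ring
      _ ≤ (d : ℝ) * (3 ^ (d - 1) * 3 ^ (d - 1)) * (8 * 2 ^ d) := by gcongr; linarith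
      _ = (d : ℝ) * 2 ^ (d + 3) * 9 ^ (d - 1) := by rw [h9, pow_add]; ring
  have hnrmR : nrm (u - v) ≤ (R : ℝ) + 1 := by
    rw [nrm_eq_max]; exact max_le (by linarith [(Nat.cast_nonneg R : (0 : ℝ) ≤ R)]) (by rw [hRdef]; linarith)
  have hnrm0 := nrm_pos (u - v)
  calc ∑ x ∈ S, f x = _ := hsplit
    _ ≤ 3 ^ b * (1 + κ) / ((R : ℝ) + 1) ^ (a + b - d)
          + (3 ^ a * (1 + κ) / ((R : ℝ) + 1) ^ (a + b - d) + 3 ^ a * (2 * κ) * 2 ^ (a + b - d) / ((R : ℝ) + 1) ^ (a + b - d)) :=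
        add_le_add hU (add_le_add hV hF)
    _ = (3 ^ b * (1 + κ) + (3 ^ a * (1 + κ) + 3 ^ a * (2 * κ) * 2 ^ (a + b - d))) / ((R : ℝ) + 1) ^ (a + b - d) := by
        rw [add_div, add_div]
    _ ≤ (d : ℝ) * 2 ^ (d + 3) * 9 ^ (d - 1) / ((R : ℝ) + 1) ^ (a + b - d) := div_le_div_of_nonneg_right hnum (by positivity)
    _ ≤ (d : ℝ) * 2 ^ (d + 3) * 9 ^ (d - 1) / nrm (u - v) ^ (a + b - d) := by
        apply div_le_div_of_nonneg_left (by positivity) (by positivity)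
        exact pow_le_pow_left₀ hnrm0.le hnrmR _

/-! ## §4 Two centres, critical (`a + b = d`), damping at one centre -/

/-- [folklore] **TWO CENTRES, CRITICAL, DAMPED** (`a, b ≤ d−1`, `a + b = d`, mass `δ∕n` at the centre `v`, `n ≥ 1`):
`Σ_{x∈S} e^{−(δ∕n)‖x−v‖∞}∕(nrm(x−u)^a·nrm(x−v)^b) ≤ 3^{d−1}·(1 + 2d·3^{d−1})·(3 + 2∕δ + log n)` — the `k·n⁻⁴(1 + log)` placement
`𝔅(ρ_u, ρ_{u′})` of the T₃ ledger (near `u`: `sum_near_le` with the damping dropped, `(R+1)^{d−a}∕(R+1)^b = 1`; elsewhere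
`1∕nrm(x−u)^a ≤ 3^a∕nrm(x−v)^a` and part 1's damped critical one-centre sum at `v`). -/
theorem sum_exp_div_nrm_pow_mul_crit_le (hd : 0 < d) {a b : ℕ} (ha : a ≤ d - 1) (hb : b ≤ d - 1) (hab : a + b = d)
    {δ : ℝ} (hδ : 0 < δ) {n : ℕ} (hn : 1 ≤ n) (S : Finset (Site d)) (u v : Site d) :
    ∑ x ∈ S, Real.exp (-(δ / n) * supNorm (x - v)) / (nrm (x - u) ^ a * nrm (x - v) ^ b)
      ≤ 3 ^ (d - 1) * (1 + 2 * d * 3 ^ (d - 1)) * (3 + 2 / δ + Real.log n) := by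
  classical
  set R := supNorm (u - v) with hRdef
  have hR0 : (0 : ℝ) < (R : ℝ) + 1 := by positivity
  have hn0 : (0 : ℝ) < n := by exact_mod_cast hn
  set κ : ℝ := 2 * d * 3 ^ (d - 1) with hκ
  have hκ0 : 0 ≤ κ := by positivity
  rw [← Finset.sum_filter_add_sum_filter_not S (fun x => 2 * supNorm (x - u) ≤ R)]
  -- near u: drop the damping
  have hU : ∑ x ∈ S.filter (fun x => 2 * supNorm (x - u) ≤ R), Real.exp (-(δ / n) * supNorm (x - v)) / (nrm (x - u) ^ a * nrm (x - v) ^ b)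
      ≤ 3 ^ b * (1 + κ) := by
    have h := sum_near_le hd ha b (S.filter (fun x => 2 * supNorm (x - u) ≤ R)) u v (fun x hx => (Finset.mem_filter.mp hx).2)
    have e : ((R : ℝ) + 1) ^ (d - a) / ((R : ℝ) + 1) ^ b = 1 := by rw [show d - a = b by omega, div_self (by positivity)]
    rw [← hRdef, mul_div_assoc, e, mul_one, ← hκ] at h
    refine le_trans (Finset.sum_le_sum fun x _ => ?_) h
    have := nrm_pos (x - u); have := nrm_pos (x - v)
    rw [div_eq_mul_one_div]
    refine mul_le_of_le_one_left (by positivity) (Real.exp_le_one_iff.mpr ?_)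
    have : (0 : ℝ) ≤ δ / n * supNorm (x - v) := by positivity
    linarith
  -- elsewhere: compare to the damped critical one-centre sum at `v`
  have hF : ∑ x ∈ S.filter (fun x => ¬2 * supNorm (x - u) ≤ R), Real.exp (-(δ / n) * supNorm (x - v)) / (nrm (x - u) ^ a * nrm (x - v) ^ b)
      ≤ 3 ^ a * (1 + κ * (2 + 2 / δ + Real.log n)) := by
    have hpt : ∀ x ∈ S.filter (fun x => ¬2 * supNorm (x - u) ≤ R),
        Real.exp (-(δ / n) * supNorm (x - v)) / (nrm (x - u) ^ a * nrm (x - v) ^ b)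
          ≤ 3 ^ a * (Real.exp (-(δ / n) * supNorm (x - v)) / nrm (x - v) ^ d) := by
      intro x hx
      have h1 := inv_nrm_pow_le_of_far (not_le.mp (Finset.mem_filter.mp hx).2) a
      have h2 := nrm_pos (x - u)
      have h3 := nrm_pos (x - v)
      have hsplit : nrm (x - v) ^ d = nrm (x - v) ^ a * nrm (x - v) ^ b := by rw [← pow_add, hab]
      calc Real.exp (-(δ / n) * supNorm (x - v)) / (nrm (x - u) ^ a * nrm (x - v) ^ b)
          = 1 / nrm (x - u) ^ a * (Real.exp (-(δ / n) * supNorm (x - v)) / nrm (x - v) ^ b) := by ring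
        _ ≤ 3 ^ a / nrm (x - v) ^ a * (Real.exp (-(δ / n) * supNorm (x - v)) / nrm (x - v) ^ b) :=
            mul_le_mul_of_nonneg_right h1 (by positivity)
        _ = 3 ^ a * (Real.exp (-(δ / n) * supNorm (x - v)) / nrm (x - v) ^ d) := by rw [hsplit]; field_simp
    calc _ ≤ ∑ x ∈ S.filter (fun x => ¬2 * supNorm (x - u) ≤ R), 3 ^ a * (Real.exp (-(δ / n) * supNorm (x - v)) / nrm (x - v) ^ d) :=
          Finset.sum_le_sum hpt
      _ = 3 ^ a * ∑ x ∈ S.filter (fun x => ¬2 * supNorm (x - u) ≤ R), Real.exp (-(δ / n) * supNorm (x - v)) / nrm (x - v) ^ d := by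
          rw [Finset.mul_sum]
      _ ≤ 3 ^ a * (1 + κ * (2 + 2 / δ + Real.log n)) :=
          mul_le_mul_of_nonneg_left (by rw [hκ]; exact sum_exp_div_nrm_pow_crit_le hd hδ hn _ v) (by positivity)
  have h3a : (3 : ℝ) ^ a ≤ 3 ^ (d - 1) := pow_le_pow_right₀ (by norm_num) ha
  have h3b : (3 : ℝ) ^ b ≤ 3 ^ (d - 1) := pow_le_pow_right₀ (by norm_num) hb
  have hlog : 0 ≤ Real.log n := Real.log_nonneg (by exact_mod_cast hn)
  have h2δ : (0 : ℝ) < 2 / δ := by positivity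
  have hL : 0 ≤ 2 + 2 / δ + Real.log n := by positivity
  have h1 : 1 + κ * (2 + 2 / δ + Real.log n) ≤ (1 + κ) * (2 + 2 / δ + Real.log n) := by
    have e : (1 + κ) * (2 + 2 / δ + Real.log n) = (2 + 2 / δ + Real.log n) + κ * (2 + 2 / δ + Real.log n) := by ring
    rw [e]; linarith
  calc _ ≤ 3 ^ b * (1 + κ) + 3 ^ a * (1 + κ * (2 + 2 / δ + Real.log n)) := add_le_add hU hF
    _ ≤ 3 ^ (d - 1) * (1 + κ) + 3 ^ (d - 1) * ((1 + κ) * (2 + 2 / δ + Real.log n)) := by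
        gcongr
    _ = 3 ^ (d - 1) * (1 + κ) * (3 + 2 / δ + Real.log n) := by ring

end Summit.QuantumFields.BalabanUV.Beta.D1BFx.LatticeHLS
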